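import Literature.Probability.RandomPlanarGeometry.SLERestrictionLemmas
import Literature.Probability.RandomPlanarGeometry.LoewnerDriverUniformStability
import Literature.Probability.RandomPlanarGeometry.LoewnerMapProofs
import HarnessLib

/-!
# Upper half of `stub_hullHausdorff` (line `bidir_windows`, crux `PathUpgradeR`,
stmt-CriticalPhenomena-18055): approximating hulls stay near the limit arc

If continuous drivers `W n → V` uniformly on `[0, T]`, the chain of `V` is generated by a simple
curve `γ` and no real point other than `V 0` is swallowed by time `T`, then for every `ε > 0`,
eventually `K_T(W n) ⊆ (γ[0, T])^ε`. Proof: Kemppainen–Smirnov Lemma 5.4 in the tree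
(`Loewner.eventually_disjoint_hull_of_tendstoUniformlyOn_driving`) applied to the compact set
`(B̄(0, R) ∩ {0 ≤ im}) ∖ (γ[0,T])^ε`, every point of which flows beyond `T` for `V` (off `ℝ` because
`K_T(V) = γ(0, T]`, `Loewner.IsGeneratedByCurve.hull_eq_image`; on `ℝ` by hypothesis), where `R` is
the a-priori radius of `Loewner.hull_subset_closedBall_driving` under the uniform driver bound.
Helper towards the registered stub (strategist's de-risking file; a prover may absorb it).
[folklore]
-/

noncomputable section

open Set Filter Metric Topology
open scoped NNReal
open UpperHalfPlane (upperHalfPlaneSet)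

namespace Summit.CriticalPhenomena.SAWScalingLimit.Theorems.PathUpgradeRHull

open Literature.Probability.RandomPlanarGeometry Literature.Probability.RandomPlanarGeometry.Loewner

/-- **Approximating hulls stay in every neighbourhood of the limit arc.** [folklore] -/
theorem eventually_hull_subset_thickening {W : ℕ → ℝ≥0 → ℝ} {V : ℝ≥0 → ℝ} {γ : ℝ≥0 → ℂ}
    {T : ℝ≥0} (hW : ∀ n, Continuous (W n)) (hV : Continuous V) (hgen : IsGeneratedByCurve V γ)
    (hs : IsSimpleTrace γ)
    (hreal : ∀ x : ℝ, x ≠ V 0 → (T : WithTop ℝ≥0) < swallowingTime V (x : ℂ))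
    (hconv : TendstoUniformlyOn W V atTop (Icc 0 T)) {ε : ℝ} (hε : 0 < ε) :
    ∀ᶠ n in atTop, hull (W n) T ⊆ thickening ε (γ '' Icc 0 T) := by
  -- (1) a uniform bound on the limit driver on `[0, T]`
  obtain ⟨C, hC⟩ := (isCompact_Icc : IsCompact (Icc (0 : ℝ≥0) T)).exists_bound_of_continuousOn
    hV.continuousOn
  have hC0 : 0 ≤ C := le_trans (norm_nonneg _) (hC 0 (left_mem_Icc.2 zero_le))
  -- (2) eventually the drivers are `1`-close on `[0, T]`
  have h1 : ∀ᶠ n in atTop, ∀ s ∈ Icc (0 : ℝ≥0) T, dist (V s) (W n s) < 1 :=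
    (Metric.tendstoUniformlyOn_iff.1 hconv) 1 one_pos
  -- (3) the compact set of points `ε`-off the arc inside the a-priori disc
  set R : ℝ := (C + 1) + ((2 * C + 2) + 4 * Real.sqrt T) with hR
  set Z : Set ℂ := (closedBall (0 : ℂ) R ∩ {z : ℂ | 0 ≤ z.im}) \ thickening ε (γ '' Icc 0 T)
    with hZ
  have hZc : IsCompact Z :=
    ((isCompact_closedBall _ _).inter_right (isClosed_le continuous_const Complex.continuous_im)).diff
      isOpen_thickening
  have hsub : γ '' Icc 0 T ⊆ thickening ε (γ '' Icc 0 T) := self_subset_thickening hε _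
  have hZflow : ∀ z ∈ Z, (T : WithTop ℝ≥0) < swallowingTime V z := by
    rintro z ⟨⟨-, hzim⟩, hzth⟩
    have hzim' : 0 ≤ z.im := hzim
    rcases hzim'.eq_or_lt with h0 | hpos
    · -- a real point other than `V 0 = γ 0`
      have hz : z = ((z.re : ℝ) : ℂ) := Complex.ext (by simp) (by simp [← h0])
      have hne : z.re ≠ V 0 := by
        intro heq
        apply hzth
        have : z = γ 0 := by rw [hz, heq, hgen.apply_zero]
        rw [this]
        exact hsub ⟨0, left_mem_Icc.2 zero_le, rfl⟩
      rw [hz]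
      exact hreal z.re hne
    · -- a point of `ℍ` off the hull `K_T(V) = γ(0, T]`
      have hzh : z ∉ hull V T := by
        intro hmem
        rw [hgen.hull_eq_image hs T] at hmem
        obtain ⟨s, hs', rfl⟩ := hmem
        exact hzth (hsub ⟨s, ⟨hs'.1.le, hs'.2⟩, rfl⟩)
      by_contra hle
      push Not at hle
      exact hzh ⟨hpos, hle⟩
  -- (4) Kemppainen–Smirnov 5.4: eventually `Z` misses the approximating hulls
  have hconv' : TendstoUniformlyOn (fun n (s : ℝ≥0) => W n s) V atTop (Iic T) :=
    hconv.mono fun s hs => ⟨zero_le, hs⟩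
  have hdisj := eventually_disjoint_hull_of_tendstoUniformlyOn_driving hV (Eventually.of_forall hW)
    hconv' hZc hZflow
  filter_upwards [hdisj, h1] with n hn hn1
  intro z hz
  have hzpos : 0 < z.im := hz.1
  by_contra hzth
  -- the a-priori radius: `K_T(W n) ⊆ B̄(W n 0, 2C + 2 + 4√T) ⊆ B̄(0, R)`
  have hWn0 : |W n 0| ≤ C + 1 := by
    have hd := hn1 0 (left_mem_Icc.2 zero_le)
    rw [Real.dist_eq] at hd
    have hV0 : |V 0| ≤ C := by simpa [Real.norm_eq_abs] using hC 0 (left_mem_Icc.2 zero_le)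
    have := abs_sub_abs_le_abs_sub (W n 0) (V 0)
    rw [abs_sub_comm] at this
    linarith
  have hS : ∀ s : ℝ≥0, s ≤ T → |W n s - W n 0| ≤ 2 * C + 2 := by
    intro s hs'
    have hd := hn1 s ⟨zero_le, hs'⟩
    rw [Real.dist_eq] at hd
    have hVs : |V s| ≤ C := by simpa [Real.norm_eq_abs] using hC s ⟨zero_le, hs'⟩
    have h3 := abs_sub_abs_le_abs_sub (W n s) (V s)
    rw [abs_sub_comm] at h3
    have hWs : |W n s| ≤ C + 1 := by linarith
    calc |W n s - W n 0| ≤ |W n s| + |W n 0| := abs_sub _ _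
      _ ≤ (C + 1) + (C + 1) := add_le_add hWs hWn0
      _ = 2 * C + 2 := by ring
  have hball := hull_subset_closedBall_driving (hW n) hS hz
  have hzR : z ∈ closedBall (0 : ℂ) R := by
    rw [mem_closedBall, dist_zero_right]
    rw [mem_closedBall, dist_eq_norm] at hball
    have hnorm0 : ‖((W n 0 : ℝ) : ℂ)‖ ≤ C + 1 := by
      rw [Complex.norm_real, Real.norm_eq_abs]; exact hWn0
    calc ‖z‖ = ‖(z - (W n 0 : ℂ)) + (W n 0 : ℂ)‖ := by rw [sub_add_cancel]
      _ ≤ ‖z - (W n 0 : ℂ)‖ + ‖((W n 0 : ℝ) : ℂ)‖ := norm_add_le _ _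
      _ ≤ ((2 * C + 2) + 4 * Real.sqrt T) + (C + 1) := add_le_add hball hnorm0
      _ = R := by rw [hR]; ring
  have hzim : z ∈ {z : ℂ | 0 ≤ z.im} := le_of_lt hzpos
  exact (Set.disjoint_left.1 hn) ⟨⟨hzR, hzim⟩, hzth⟩ hz

end Summit.CriticalPhenomena.SAWScalingLimit.Theorems.PathUpgradeRHull

end
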